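import Summits.NavierStokesRegularity.NavierStokesRegularity.Theses.RotatedEulerWindow
import HarnessLib

/-!
# Crux `EmptyEulerWindow` (stmt-NavierStokesRegularity-11273): the matched-decay clause and the
# normalisation are load-bearing

Negative (load-bearing-hypothesis) lemmas of the refuter for the crux `EmptyEulerWindow`, shared
verbatim by the route files `VortexLineClock`, `AffineBernoulli` and `RotatedEulerWindow` (the three
decls are `Iff.rfl`-equal). The crux says that NO `(γ, U, Ω)` satisfies the window-profile clauses:
`2/5 ≤ γ < 1/2`, `U ∈ C²`, `Ω ∈ C¹`, `div U = 0`, `m Ω = curl U` (`m > 0`), `U, Ω` globally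
Lipschitz, the self-similar Euler profile equations `(1−γ)U + DU·(γ(y−c)+U) + ∇P = 0` and
`DΩ·(γ(y−c)+U) − DU·Ω = −Ω`, the CIV matched decay `|Ω| ≤ C⟨y⟩^{−1/γ}`, `|U| ≤ C⟨y⟩^{1−1/γ}`,
and `‖Ω 0‖ = 1`.

* `emptyEulerWindow_false_without_decay` — the crux with ONLY the decay conjunct deleted is FALSE:
  all remaining clauses hold (for every `γ`; instantiated at `γ = 2/5`) for the linear stretched
  vortex `U y = A y = (y₁, 2y₀ − y₁, y₂)`, `A = !![0, 1, 0; 2, -1, 0; 0, 0, 1]` (`tr A = 0`,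
  `A + A² = 2·Id`, `A e₂ = e₂`, `curl U ≡ e₂`), with `Ω ≡ e₂`, `m = 1`, `c = 0`, `P y = −‖y‖²`
  (`∇P = −2y = −(A + A²)y`). So any proof of the crux must use the decay clause — it is the only
  clause excluding the affine self-similar profiles (stagnation-point / stretched-vortex flows,
  whose vortex lines are straight and wandering), and it is the clause a recurrence step consumes.
* `emptyEulerWindow_false_without_normalisation` — the crux with ONLY `‖Ω 0‖ = 1` deleted is FALSE:
  the zero profile satisfies every other clause, decay included (the normalisation is exactly the
  junk guard).

Both witnesses also certify that the two typed profile equations are mutually sign-consistent on a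
non-trivial instance (the vorticity clause is the curl of the velocity clause). [folklore]
-/

noncomputable section

open WithLp
open Literature.Analysis.FluidPDE
open scoped InnerProductSpace RealInnerProductSpace ContDiff

namespace Summit.NavierStokesRegularity.NavierStokesRegularity.Theorems.EmptyEulerWindow.Negative

/-- `∇(−‖y‖²) = −2y` on `ℝ³`. [folklore] -/
theorem hasGradientAt_neg_norm_sq (y : EuclideanSpace ℝ (Fin 3)) :
    HasGradientAt (fun z : EuclideanSpace ℝ (Fin 3) => -‖z‖ ^ 2) ((-2 : ℝ) • y) y := by
  have h : HasFDerivAt (fun z : EuclideanSpace ℝ (Fin 3) => -‖z‖ ^ 2) (-(2 • innerSL ℝ y)) y :=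
    (hasStrictFDerivAt_norm_sq y).hasFDerivAt.fun_neg
  refine hasGradientAt_iff_hasFDerivAt.mpr (h.congr_fderiv ?_)
  ext v
  simp [InnerProductSpace.toDual_apply_apply, innerSL_apply_apply, two_mul]

/-- `gradient (−‖·‖²) y = −2y` on `ℝ³`. [folklore] -/
theorem gradient_neg_norm_sq (y : EuclideanSpace ℝ (Fin 3)) :
    gradient (fun z : EuclideanSpace ℝ (Fin 3) => -‖z‖ ^ 2) y = (-2 : ℝ) • y :=
  (hasGradientAt_neg_norm_sq y).gradient

/-- The linear stretched vortex `U y = (y₁, 2y₀ − y₁, y₂)` as a continuous linear map of `ℝ³`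
(existence form, so that no definition is introduced). [folklore] -/
theorem exists_stretchedVortexCLM :
    ∃ L : EuclideanSpace ℝ (Fin 3) →L[ℝ] EuclideanSpace ℝ (Fin 3),
      ∀ y, L y = toLp 2 ![y 1, 2 * y 0 - y 1, y 2] :=
  ⟨LinearMap.toContinuousLinearMap
      { toFun := fun y => toLp 2 ![y 1, 2 * y 0 - y 1, y 2]
        map_add' := fun v w => by ext i; fin_cases i <;> (simp; try ring)
        map_smul' := fun c v => by ext i; fin_cases i <;> (simp; try ring) },
    fun _ => rfl⟩

/-! ### The decay clause is load-bearing -/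

/-- **The matched-decay clause of `EmptyEulerWindow` is load-bearing.** Deleting ONLY the conjunct
`∃ C, ∀ y, ‖Ω y‖ ≤ C (1+‖y‖)^(−1/γ) ∧ ‖U y‖ ≤ C (1+‖y‖)^(1−1/γ)` from the crux
(stmt-NavierStokesRegularity-11273, verbatim otherwise) makes it false: witness `γ = 2/5`,
`U y = A y = (y₁, 2y₀ − y₁, y₂)` (`tr A = 0`, `A + A² = 2·Id`, `A e₂ = e₂`), `Ω ≡ e₂ = curl U`,
`m = 1`, common Lipschitz constant `‖A‖`, `c = 0`, `P = −‖·‖²`. [folklore] -/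
theorem emptyEulerWindow_false_without_decay :
    ¬ (∀ (γ : ℝ) (U Ω : EuclideanSpace ℝ (Fin 3) → EuclideanSpace ℝ (Fin 3)),
      ¬ ((2 / 5 : ℝ) ≤ γ ∧ γ < 1 / 2 ∧ ContDiff ℝ 2 U ∧ ContDiff ℝ 1 Ω ∧
        Literature.Analysis.FluidPDE.VectorCalculus.IsDivFree U ∧
        (∃ m : ℝ, 0 < m ∧ ∀ y, m • Ω y = Literature.Analysis.FluidPDE.curl U y) ∧
        (∃ L : NNReal, LipschitzWith L U ∧ LipschitzWith L Ω) ∧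
        (∃ (c : EuclideanSpace ℝ (Fin 3)) (P : EuclideanSpace ℝ (Fin 3) → ℝ), ContDiff ℝ 1 P ∧
          (∀ y, (1 - γ) • U y + fderiv ℝ U y (γ • (y - c) + U y) + gradient P y = 0) ∧
          (∀ y, fderiv ℝ Ω y (γ • (y - c) + U y) - fderiv ℝ U y (Ω y) = -(Ω y))) ∧
        ‖Ω 0‖ = 1)) := by
  intro h
  obtain ⟨A, hA⟩ := exists_stretchedVortexCLM
  -- `div U = tr A = 0`
  have hdiv : VectorCalculus.IsDivFree (A : EuclideanSpace ℝ (Fin 3) → EuclideanSpace ℝ (Fin 3)) :=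
    fun y => by
      rw [divergence_eq_sum_inner_fderiv (EuclideanSpace.basisFun (Fin 3) ℝ),
        ContinuousLinearMap.fderiv]
      simp [Fin.sum_univ_three, hA, EuclideanSpace.inner_single_left]
  -- `curl U ≡ e₂` (`∂₀U₁ − ∂₁U₀ = 2 − 1`)
  have hcurl : ∀ y, curl A y = EuclideanSpace.single 2 1 := fun y => by
    ext i
    fin_cases i <;> simp [curl, ContinuousLinearMap.fderiv, hA]
    norm_num
  -- `A e₂ = e₂`: the stretching exactly balances the self-similar damping `−Ω`
  have hAe : A (EuclideanSpace.single 2 1) = EuclideanSpace.single 2 1 := by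
    ext i
    fin_cases i <;> simp [hA]
  refine h (2 / 5) A (fun _ => EuclideanSpace.single 2 1)
    ⟨by norm_num, by norm_num, A.contDiff, contDiff_const, hdiv, ⟨1, one_pos, fun y => ?_⟩,
      ⟨‖A‖₊, A.lipschitz, (LipschitzWith.const (EuclideanSpace.single 2 1)).weaken (by simp)⟩,
      ⟨0, fun z => -‖z‖ ^ 2, (contDiff_norm_sq ℝ).neg, fun y => ?_, fun y => ?_⟩, by simp⟩
  · -- `1 • e₂ = curl U y`
    simp [hcurl]
  · -- velocity clause: `(1−γ)Ay + A(γy + Ay) − 2y = (A + A² − 2)y = 0`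
    rw [ContinuousLinearMap.fderiv, gradient_neg_norm_sq, sub_zero]
    ext i
    fin_cases i <;> simp [hA] <;> ring
  · -- vorticity clause: `0 − A e₂ = −e₂`
    simp [ContinuousLinearMap.fderiv, hAe]

/-! ### The normalisation is load-bearing (junk guard) -/

/-- **The normalisation `‖Ω 0‖ = 1` of `EmptyEulerWindow` is load-bearing.** Deleting ONLY that
conjunct from the crux (stmt-NavierStokesRegularity-11273, verbatim otherwise) makes it false: the
zero profile `U = Ω = 0` (`γ = 2/5`, `m = 1`, `L = 0`, `c = 0`, `P = 0`, `C = 0`) satisfies every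
other clause, decay included. [folklore] -/
theorem emptyEulerWindow_false_without_normalisation :
    ¬ (∀ (γ : ℝ) (U Ω : EuclideanSpace ℝ (Fin 3) → EuclideanSpace ℝ (Fin 3)),
      ¬ ((2 / 5 : ℝ) ≤ γ ∧ γ < 1 / 2 ∧ ContDiff ℝ 2 U ∧ ContDiff ℝ 1 Ω ∧
        Literature.Analysis.FluidPDE.VectorCalculus.IsDivFree U ∧
        (∃ m : ℝ, 0 < m ∧ ∀ y, m • Ω y = Literature.Analysis.FluidPDE.curl U y) ∧
        (∃ L : NNReal, LipschitzWith L U ∧ LipschitzWith L Ω) ∧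
        (∃ (c : EuclideanSpace ℝ (Fin 3)) (P : EuclideanSpace ℝ (Fin 3) → ℝ), ContDiff ℝ 1 P ∧
          (∀ y, (1 - γ) • U y + fderiv ℝ U y (γ • (y - c) + U y) + gradient P y = 0) ∧
          (∀ y, fderiv ℝ Ω y (γ • (y - c) + U y) - fderiv ℝ U y (Ω y) = -(Ω y))) ∧
        (∃ C : ℝ, ∀ y, ‖Ω y‖ ≤ C * (1 + ‖y‖) ^ (-(1 / γ)) ∧
          ‖U y‖ ≤ C * (1 + ‖y‖) ^ (1 - 1 / γ)))) := by
  intro h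
  refine h (2 / 5) (fun _ => 0) (fun _ => 0)
    ⟨by norm_num, by norm_num, contDiff_const, contDiff_const, fun y => ?_,
      ⟨1, one_pos, fun y => ?_⟩, ⟨0, LipschitzWith.const 0, LipschitzWith.const 0⟩,
      ⟨0, fun _ => 0, contDiff_const, fun y => by simp, fun y => by simp⟩,
      ⟨0, fun y => by simp⟩⟩
  · -- `div 0 = 0`
    simp [VectorCalculus.divergence]
  · -- `curl 0 = 0`
    ext i
    fin_cases i <;> simp [curl]

end Summit.NavierStokesRegularity.NavierStokesRegularity.Theorems.EmptyEulerWindow.Negative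

end
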